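import Mathlib
import HarnessLib
import Literature.MathematicalPhysics.QuantumLattice.DWaveSourceProofs
import Literature.MathematicalPhysics.QuantumLattice.PairFieldMomentum
import Literature.MathematicalPhysics.QuantumLattice.HubbardModelGrandCanonicalProofs
import Literature.MathematicalPhysics.QuantumLattice.FermionOperatorsNumberEigenspaceProofs
import Summits.HubbardSuperconductivity.HubbardSuperconductivity.Theorems.WeakCouplingBCSWcbcsBcsConstructionTrialStateSectors

/-!
# Crux `WcbcsBcsConstruction`, line `lro-seed-kink-bridge`: stub `stub_trialStateBound`

Crux item stmt-HubbardSuperconductivity-2010 (route `HubbardSuperconductivity/WeakCouplingBCS`),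
line `lro-seed-kink-bridge`, stub S1c of the lead's skeleton: GIVEN the volume bounds
`‖H(1,U) - μN‖ ≤ B₁(1+U+|μ|)L²` (stub S1a) and `‖[O,[O,H]]‖ ≤ B₂(1+U+|μ|)L²` (stub S1b) for the
grand-canonical Hubbard Hamiltonian `H = hubbardTorusWith 2 L 1 U μ` on the torus `(ℤ/Lℤ)²` and the
`d`-wave order operator `O = Δ_d + Δ_d†`, `Δ_d = pairField dWaveFormFactor L`, every normalised
`n`-particle vector `Ψ` with `⟨Ψ, O²Ψ⟩ ≥ s² > 0` gives, for the sourced Hamiltonian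
`dWaveSourceTorus L U μ h = H - hO` (`h ≥ 0`), the Koma–Tasaki trial-state bound
`E₀(H - hO) ≤ E₀ + e/2 + B(1+U+|μ|)L³√e/s + B(1+U+|μ|)L²/s² - hs`, `e = Re⟨Ψ,HΨ⟩ - E₀(H)`
(T. Koma, H. Tasaki, J. Stat. Phys. 76 (1994) 745, proof of Theorem 2.2, adapted to a
near-eigenvector `Ψ`).

The matrix analysis (selection rules, Gram factorisation, the abstract bound
`stub_wcbcsTrialStateAbstract`) is in `WeakCouplingBCSWcbcsBcsConstructionTrialStateSectors`;
here: the real arithmetic inserting the volume bounds, the particle-number bookkeeping on the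
torus (`[N, Δ_d] = -2Δ_d`, `[N, H] = 0`, `NΨ = nΨ`, from `PairFieldMomentum`,
`HubbardModelGrandCanonicalProofs`, `FermionOperatorsNumberEigenspaceProofs`), and the stub with
`B = √(2B₁) · 2(2Σ_e|d(e)/√2|)/2 + B₂/4` (`‖O‖ ≤ 2‖Δ_d‖ ≤ 2(2Σ_e|d(e)/√2|)L²`, `norm_pairField_le`).
No definitions; everything is proved.
-/

set_option linter.dupNamespace false

namespace Summit.HubbardSuperconductivity.HubbardSuperconductivity.Theorems

open Literature.MathematicalPhysics.QuantumLattice Literature.Probability.LatticeModels Matrix Filter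
open scoped Matrix.Norms.L2Operator ComplexOrder Topology

namespace WcbcsTrialState

/-! ### Real arithmetic: inserting the volume bounds -/

/-- Inserting `‖H‖ ≤ B₁KL²`, `‖O‖ ≤ 2B_dL²`, `‖[O,[O,H]]‖ ≤ B₂KL²` (`K = 1 + U + |μ| ≥ 1`) into
the abstract trial-state bound: `√(2‖H‖)‖O‖/(2s) ≤ √(2B₁)B_d K L³/s` (`√K ≤ K`) and
`‖[O,[O,H]]‖/(4s²) ≤ (B₂/4) K L²/s²`. [folklore] -/
theorem trial_bound_arith {E' E₀ e nH nO nD s h K L B₁ B₂ Bd : ℝ} (hB₁ : 0 < B₁)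
    (hB₂ : 0 ≤ B₂) (hBd : 0 ≤ Bd) (hs : 0 < s) (hK : 1 ≤ K) (hL : 0 < L)
    (hnH : nH ≤ B₁ * K * L ^ 2) (hnO : nO ≤ 2 * Bd * L ^ 2) (hnD : nD ≤ B₂ * K * L ^ 2)
    (hnO0 : 0 ≤ nO)
    (hkey : E' ≤ E₀ + e / 2 + Real.sqrt (2 * nH) * nO * Real.sqrt e / (2 * s) +
      nD / (4 * s ^ 2) - h * s) :
    E' ≤ E₀ + e / 2 + (Real.sqrt (2 * B₁) * Bd + B₂ / 4) * K * L ^ 3 * Real.sqrt e / s +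
      (Real.sqrt (2 * B₁) * Bd + B₂ / 4) * K * L ^ 2 / s ^ 2 - h * s := by
  have hK0 : 0 ≤ K := by linarith
  have hsqrtK : Real.sqrt K ≤ K := by
    rw [Real.sqrt_le_left hK0]
    nlinarith
  have h1 : Real.sqrt (2 * nH) ≤ Real.sqrt (2 * B₁) * K * L := by
    calc Real.sqrt (2 * nH) ≤ Real.sqrt (2 * B₁ * (K * L ^ 2)) :=
          Real.sqrt_le_sqrt (by nlinarith [hnH])
      _ = Real.sqrt (2 * B₁) * (Real.sqrt K * L) := by
          rw [Real.sqrt_mul (by positivity), Real.sqrt_mul hK0, Real.sqrt_sq hL.le]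
      _ ≤ Real.sqrt (2 * B₁) * (K * L) := by gcongr
      _ = Real.sqrt (2 * B₁) * K * L := by ring
  have h2 : Real.sqrt (2 * nH) * nO ≤ (Real.sqrt (2 * B₁) * K * L) * (2 * Bd * L ^ 2) :=
    mul_le_mul h1 hnO hnO0 (by positivity)
  have h3 : Real.sqrt (2 * nH) * nO * Real.sqrt e * s ≤
      (Real.sqrt (2 * B₁) * K * L) * (2 * Bd * L ^ 2) * Real.sqrt e * s :=
    mul_le_mul_of_nonneg_right (mul_le_mul_of_nonneg_right h2 (Real.sqrt_nonneg e)) hs.le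
  have hT : Real.sqrt (2 * nH) * nO * Real.sqrt e / (2 * s) ≤
      Real.sqrt (2 * B₁) * Bd * K * L ^ 3 * Real.sqrt e / s := by
    rw [div_le_div_iff₀ (by positivity) hs]
    nlinarith [h3]
  have hX3 : 0 ≤ K * L ^ 3 * Real.sqrt e / s := by positivity
  have hX2 : 0 ≤ K * L ^ 2 / s ^ 2 := by positivity
  have hc3 : Real.sqrt (2 * B₁) * Bd ≤ Real.sqrt (2 * B₁) * Bd + B₂ / 4 := by linarith
  have hc2 : B₂ / 4 ≤ Real.sqrt (2 * B₁) * Bd + B₂ / 4 := by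
    have := mul_nonneg (Real.sqrt_nonneg (2 * B₁)) hBd
    linarith
  have hT' : Real.sqrt (2 * B₁) * Bd * K * L ^ 3 * Real.sqrt e / s ≤
      (Real.sqrt (2 * B₁) * Bd + B₂ / 4) * K * L ^ 3 * Real.sqrt e / s := by
    have := mul_le_mul_of_nonneg_right hc3 hX3
    calc Real.sqrt (2 * B₁) * Bd * K * L ^ 3 * Real.sqrt e / s
        = Real.sqrt (2 * B₁) * Bd * (K * L ^ 3 * Real.sqrt e / s) := by ring
      _ ≤ (Real.sqrt (2 * B₁) * Bd + B₂ / 4) * (K * L ^ 3 * Real.sqrt e / s) := this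
      _ = _ := by ring
  have hD : nD / (4 * s ^ 2) ≤ B₂ / 4 * K * L ^ 2 / s ^ 2 := by
    rw [div_le_div_iff₀ (by positivity) (by positivity)]
    nlinarith [hnD, sq_nonneg s]
  have hD' : B₂ / 4 * K * L ^ 2 / s ^ 2 ≤
      (Real.sqrt (2 * B₁) * Bd + B₂ / 4) * K * L ^ 2 / s ^ 2 := by
    have := mul_le_mul_of_nonneg_right hc2 hX2
    calc B₂ / 4 * K * L ^ 2 / s ^ 2 = B₂ / 4 * (K * L ^ 2 / s ^ 2) := by ring
      _ ≤ (Real.sqrt (2 * B₁) * Bd + B₂ / 4) * (K * L ^ 2 / s ^ 2) := this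
      _ = _ := by ring
  linarith [hkey, hT, hT', hD, hD']

/-! ### Particle-number bookkeeping on the torus -/

/-- `[N, Δ_d] = -2 Δ_d` for the `d`-wave pair field on the torus. [folklore] -/
theorem totalNumber_commutator_pairField_dWave (L : ℕ) [NeZero L] :
    totalNumber * pairField dWaveFormFactor L - pairField dWaveFormFactor L * totalNumber =
      ((-2 : ℝ) : ℂ) • pairField dWaveFormFactor L := by
  have h := totalNumber_commutator_pairFieldAt dWaveFormFactor L 0
  rw [pairFieldAt_zero] at h
  rw [h, Complex.ofReal_neg, Complex.ofReal_ofNat]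

/-- `[N, H(1,U) - μN] = 0` on the torus (particle-number conservation). [folklore] -/
theorem totalNumber_commutator_hubbardTorusWith (L : ℕ) (U μ : ℝ) :
    totalNumber * hubbardTorusWith 2 L 1 U μ - hubbardTorusWith 2 L 1 U μ * totalNumber =
      ((0 : ℝ) : ℂ) • hubbardTorusWith 2 L 1 U μ := by
  rw [Complex.ofReal_zero, zero_smul, sub_eq_zero]
  exact (hamiltonianWith_commute_totalNumber (fermionTorusGraph 2 L) 1 U μ).symm.eq

/-- An `n`-particle vector is an eigenvector of `N` with eigenvalue `n`. [folklore] -/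
theorem totalNumber_mulVec_of_isNParticle {L n : ℕ} {Ψ : Fock (Orb (FermionTorus 2 L))}
    (hΨ : IsNParticle n Ψ) :
    (totalNumber : Matrix _ _ ℂ) *ᵥ Ψ = ((n : ℝ) : ℂ) • Ψ := by
  have hmem := (mem_nParticleSubmodule_iff n Ψ).2 hΨ
  rw [nParticleSubmodule_eq_eigenspace_holds n, Module.End.mem_eigenspace_iff] at hmem
  change totalNumberOp *ᵥ Ψ = (n : ℂ) • Ψ at hmem
  rw [totalNumberOp_eq_totalNumber] at hmem
  rw [hmem, Complex.ofReal_natCast]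

/-- `‖Δ_d + Δ_d†‖ ≤ 2 · (2 Σ_e |d e/√2|) · L²`. [folklore] -/
theorem norm_pairField_add_conjTranspose_le (L : ℕ) [NeZero L] :
    ‖pairField dWaveFormFactor L + (pairField dWaveFormFactor L)ᴴ‖ ≤
      2 * (2 * ∑ e ∈ insert (0 : Site 2) unitSteps, |dWaveFormFactor e / Real.sqrt 2|) *
        (L : ℝ) ^ 2 := by
  have h := norm_pairField_le dWaveFormFactor L
  calc ‖pairField dWaveFormFactor L + (pairField dWaveFormFactor L)ᴴ‖
      ≤ ‖pairField dWaveFormFactor L‖ + ‖(pairField dWaveFormFactor L)ᴴ‖ := norm_add_le _ _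
    _ = 2 * ‖pairField dWaveFormFactor L‖ := by rw [l2_opNorm_conjTranspose]; ring
    _ ≤ _ := by nlinarith [h]

end WcbcsTrialState

open WcbcsTrialState in
/-- Stub S1c of line `lro-seed-kink-bridge`. The Koma–Tasaki trial-state computation: GIVEN the
norm bound S1a and the double-commutator bound S1b, every normalised number-definite `Ψ` with
`⟨Ψ, O²Ψ⟩ ≥ s² > 0` yields, through the trial vector `Ξ = (Ψ + OΨ/‖OΨ‖)/√2`
(`⟨Ψ, OΨ⟩ = ⟨OΨ, O²Ψ⟩ = ⟨HΨ, OΨ⟩ = 0` by particle number;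
`2⟨OΨ, H OΨ⟩ = 2Re⟨O²Ψ, HΨ⟩ - ⟨Ψ, [O,[O,H]]Ψ⟩`,
`|⟨O²Ψ, (H - E₀)Ψ⟩| ≤ ‖O‖ ‖OΨ‖ √(2‖H‖·excess)`), the variational bound
`E₀(H - hO) ≤ ⟨Ξ, (H - hO)Ξ⟩ ≤ E₀ + excess/2 + B(1+U+|μ|)L³√excess/s + B(1+U+|μ|)L²/s² - hs`.
[cite: KomaTasaki1994, Theorem 2.2] -/
theorem stub_trialStateBound :
    (∃ B₁ : ℝ, 0 < B₁ ∧ ∀ (L : ℕ) [NeZero L] (U μ : ℝ), 0 ≤ U →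
      ‖hubbardTorusWith 2 L 1 U μ‖ ≤ B₁ * (1 + U + |μ|) * (L : ℝ) ^ 2) →
    (∃ B₂ : ℝ, 0 < B₂ ∧ ∀ (L : ℕ) [NeZero L] (U μ : ℝ), 0 ≤ U →
      ‖(pairField dWaveFormFactor L + (pairField dWaveFormFactor L)ᴴ) *
            ((pairField dWaveFormFactor L + (pairField dWaveFormFactor L)ᴴ) * hubbardTorusWith 2 L 1 U μ -
              hubbardTorusWith 2 L 1 U μ * (pairField dWaveFormFactor L + (pairField dWaveFormFactor L)ᴴ)) -
          ((pairField dWaveFormFactor L + (pairField dWaveFormFactor L)ᴴ) * hubbardTorusWith 2 L 1 U μ -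
              hubbardTorusWith 2 L 1 U μ * (pairField dWaveFormFactor L + (pairField dWaveFormFactor L)ᴴ)) *
            (pairField dWaveFormFactor L + (pairField dWaveFormFactor L)ᴴ)‖ ≤
        B₂ * (1 + U + |μ|) * (L : ℝ) ^ 2) →
    ∃ B : ℝ, 0 < B ∧ ∀ (L : ℕ) [NeZero L] (U μ h s : ℝ), 0 ≤ U → 0 ≤ h → 0 < s →
      ∀ (Ψ : Fock (Orb (FermionTorus 2 L))) (n : ℕ), star Ψ ⬝ᵥ Ψ = 1 → IsNParticle n Ψ →
        s ^ 2 ≤ (expect ((pairField dWaveFormFactor L + (pairField dWaveFormFactor L)ᴴ) *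
          (pairField dWaveFormFactor L + (pairField dWaveFormFactor L)ᴴ)) Ψ).re →
        (dWaveSourceTorus L U μ h).groundEnergy ≤
          (hubbardTorusWith 2 L 1 U μ).groundEnergy +
            ((expect (hubbardTorusWith 2 L 1 U μ) Ψ).re - (hubbardTorusWith 2 L 1 U μ).groundEnergy) / 2 +
            B * (1 + U + |μ|) * (L : ℝ) ^ 3 *
              Real.sqrt ((expect (hubbardTorusWith 2 L 1 U μ) Ψ).re - (hubbardTorusWith 2 L 1 U μ).groundEnergy) / s +
            B * (1 + U + |μ|) * (L : ℝ) ^ 2 / s ^ 2 - h * s := by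
  rintro ⟨B₁, hB₁, hHn⟩ ⟨B₂, hB₂, hDn⟩
  have hBd0 : 0 ≤ 2 * ∑ e ∈ insert (0 : Site 2) unitSteps, |dWaveFormFactor e / Real.sqrt 2| :=
    by positivity
  refine ⟨Real.sqrt (2 * B₁) * (2 * ∑ e ∈ insert (0 : Site 2) unitSteps,
    |dWaveFormFactor e / Real.sqrt 2|) + B₂ / 4, by positivity, ?_⟩
  intro L _ U μ h s hU hh hs Ψ n hΨ1 hΨn hs2
  have hNh : (totalNumber : Matrix (Finset (Orb (FermionTorus 2 L))) _ ℂ).IsHermitian :=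
    totalNumber_isHermitian
  have hNΨ := totalNumber_mulVec_of_isNParticle hΨn
  have hNΔ := totalNumber_commutator_pairField_dWave L
  simp only [expect] at hs2 ⊢
  have key := stub_wcbcsTrialStateAbstract (isHermitian_hubbardTorusWith L 1 U μ)
    (isHermitian_pairField_add_conjTranspose L) hΨ1
    (star_dotProduct_charged_mulVec_eq_zero hNh hNΔ hNΨ)
    (star_mulVec_dotProduct_charged_mulVec_eq_zero hNh hNΔ
      (totalNumber_commutator_hubbardTorusWith L U μ) hNΨ)
    (star_charged_mulVec_dotProduct_eq_zero hNh hNΔ hNΨ) hs hh hs2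
  rw [dWaveSourceTorus_eq]
  have hK1 : 1 ≤ 1 + U + |μ| := by
    have := abs_nonneg μ
    linarith
  have hL : (0 : ℝ) < L := by exact_mod_cast Nat.pos_of_ne_zero (NeZero.ne L)
  exact trial_bound_arith hB₁ hB₂.le hBd0 hs hK1 hL (hHn L U μ hU)
    (norm_pairField_add_conjTranspose_le L) (hDn L U μ hU) (norm_nonneg _) key

end Summit.HubbardSuperconductivity.HubbardSuperconductivity.Theorems
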